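import Literature.AlgebraicGeometry.Frobenioids.ArchimedeanFSMITestsReal
import Literature.AlgebraicGeometry.Frobenioids.ArchimedeanSlitMorphisms
import Literature.AlgebraicGeometry.Frobenioids.ArchimedeanRealObjectsIso
import Literature.AlgebraicGeometry.Frobenioids.CategoriesFactorizationRevised
import HarnessLib

/-!
# Frobenioids II, Proposition 3.4 (viii) for `F₀ = N₀`: FSMI-morphisms lower the potential;
# condition (b) of "FSMFF-type" (2008 and 2024 forms) for the non-rigidified angloid `N₀`

Mochizuki, *The geometry of Frobenioids II: poly-Frobenioids*, Kyushu J. Math. **62** (2008)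
401–460, §3, proof of Proposition 3.4 (viii), p. 32 ll. 5–30 [cite: MochizukiFrdII2008, Prop 3.4 (viii) p.32];
author's *Comments* (Feb 2019) (4): "all morphisms between real objects of `N₀` are isomorphisms";
[FrdI] *Comments* (Jan 2024) (28): the revised condition (b) of "FSMFF-type".

PROOF-ONLY file (abc-iut cell, layer L1, sub-DAG `SUBDAG-FrdII-Prop34.md` rows **P34-L10**
`F0RealFSMIsIso` and **P34-L11** `F0ComplexNonLinearBound` for `F₀ = N₀`, seat abc-iut-w5-d092;
consumed BY NAME by row P34-L13 `FChainBound`, abc-iut-w5-d152). For the absolute non-rigidified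
angloid `N₀` (Ex. 3.3 (iii), abc-iut-L1-t6's `ArchFrd.N0`):

* (the tree's `N0.isIso_of_isRealObj`, `ArchimedeanRealObjectsIso.lean`: an arrow between real objects of
  `N₀` is an isomorphism — Comments (4); p. 32 ll. 7–9 — is used by name);
* `N0.not_isFSMI_of_isComplex_of_isReal` — there is no FSMI-morphism from a complex to a real object
  (a non-isotropic source factors through its isotropic hull; an isotropic source carries the conjugation
  automorphism equalised by the arrow, so the arrow is not a monomorphism); hence "every FSMI-morphism of
  `F₀` has complex domain and codomain" (p. 32 ll. 13–14): `N0.isComplexObj_of_isFSMI`;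
* `N0.isIsotropic_of_isFSMI` — a (necessarily linear) FSMI-morphism between complex objects has
  non-isotropic domain and isotropic codomain ("either an isomorphism or a slit morphism", p. 32 l. 17,
  via Lemma 3.2 (ix): `C0.isIsotropic_of_linear_lifts`);
* `N0.fsmiRank_lt_of_isFSMI` — the FSMI-potential `C0.fsmiRank` DROPS along every FSMI-morphism;
* `N0.isFSMIChain_le`, `N0.bounded_isFSMIChain`, **`N0.bounded_headedFSMIChain`** — the number of
  FSMI-morphisms in any composable chain out of `A` is `≤ C0.fsmiRank A + 1`: condition (b) of
  "FSMFF-type" for `N₀` in both the printed (2008) and the revised (2024, arbitrary head) forms.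

HONEST SCOPE: condition (a) of "FSMFF-type" FAILS for `N₀` as an absolute category (abc-iut-L1-d3's
`N_id_not_isOfFSMFFType`, FLAG #17: the complex→real FSM-morphism has no FSMI-factorisation), so no
claim "`N₀` is of FSMFF-type" is made here; what is proved is the bound (b), which is what the repaired
Prop. 3.4 (viii) (complex regime) consumes. [FrdII] §3 is classical and undisputed.
-/

namespace Literature.AlgebraicGeometry.Frobenioids

open Set Function Topology Real CategoryTheory
open scoped Pointwise

noncomputable section

namespace ArchFrd

namespace N0

variable {P Q : N0}

/-- The data of an arrow of `N₀`: a linear isometry of `C₀`. [cite: MochizukiFrdII2008, Ex 3.3 (iii) p.29] -/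
theorem homCarrier_data (φ : P ⟶ Q) :
    C0.degFr (homCarrier φ) = 1 ∧ PreFrobenioid.IsIsometry C0.toElem (homCarrier φ) :=
  ⟨φ.2, φ.1.2⟩

/-- An arrow of `N₀` is an isomorphism iff its underlying `C₀`-arrow is.
[cite: MochizukiFrdII2008, Ex 3.3 (iii) p.29] -/
theorem isIso_iff_isIso_carrier (φ : P ⟶ Q) : IsIso φ ↔ IsIso (homCarrier φ) := by
  constructor
  · intro h; exact (inferInstance : IsIso (toC0.map φ))
  · intro h; exact isIso_of_isIso_carrier φ

/-! ### Real objects -/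

-- «All arrows between real objects of `N₀` are isomorphisms» (author's Comments (4); p. 32 ll. 7–9) is
-- the tree's `ArchFrd.N0.isIso_of_isRealObj` (`ArchimedeanRealObjectsIso.lean`), used below by name.

/-- The codomain of an arrow out of a real object is real. [cite: MochizukiFrdII2008, Ex 3.3 (i) p.27] -/
theorem isRealObj_of_hom (φ : P ⟶ Q) (hP : P.IsRealObj) : Q.IsRealObj :=
  C0.isRealObj_of_hom (homCarrier φ) hP

/-! ### No FSMI-morphism from a complex object to a real object -/

/-- **No irreducible arrow of `N₀` goes from a complex object to a real object**, hence no
FSMI-morphism does (p. 32 ll. 13–14 "every FSMI-morphism of `F₀` has complex domain and codomain").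
[cite: MochizukiFrdII2008, Prop 3.4 (viii) p.32] -/
theorem not_isFSMI_of_isComplex_of_isReal (φ : P ⟶ Q) (hP : P.carrier.IsComplexObj)
    (hQ : Q.IsRealObj) : ¬ IsFSMI φ := by
  rintro ⟨⟨-, hmono⟩, hnot, hirr⟩
  by_cases hPi : P.carrier.region.IsIsotropic
  · -- isotropic source: the conjugation automorphism is equalised by `φ`
    obtain ⟨s, hs, hsd⟩ := C0.exists_conj_ratio (C0.scalar (homCarrier φ))
    have hρiso : PreFrobenioid.IsIsometry C0.toElem (C0.conjHom P.carrier hP hPi s hs) := by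
      rw [A0.isIsometry_iff_norm_mul_tip_pow]
      change ‖(s : ℂ)‖ * P.carrier.tip ^ ((1 : ℕ+) : ℕ) = P.carrier.tip
      rw [hs, one_mul, PNat.one_coe, pow_one]
    let ρ : P ⟶ P := homMk (C0.conjHom P.carrier hP hPi s hs) hρiso rfl
    have hρφ : ρ ≫ φ = 𝟙 P ≫ φ := by
      rw [Category.id_comp]
      apply hom_ext
      rw [homCarrier_comp, homCarrier_homMk]
      refine C0.conjHom_comp hP hPi hs (homCarrier φ) hQ ?_
      rw [(homCarrier_data φ).1]; exact hsd
    have hρ : ρ = 𝟙 P := hmono.right_cancellation _ _ hρφ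
    exact C0.conjHom_ne_id hP hPi hs (by
      have := congrArg homCarrier hρ
      rwa [homCarrier_homMk, homCarrier_id] at this)
  · -- non-isotropic source: factor through the isotropic hull
    let M : N0 := ⟨⟨C0.isotropify P.carrier⟩⟩
    have htiso : PreFrobenioid.IsIsometry C0.toElem (C0.toIsotropic P.carrier) :=
      (A0.isIsometry_iff_ratio_eq_one _).2 (C0.ratio_toIsotropic _)
    have hliso : PreFrobenioid.IsIsometry C0.toElem (C0.liftIsotropify (homCarrier φ) hQ) := by
      rw [A0.isIsometry_iff_norm_mul_tip_pow]
      exact (A0.isIsometry_iff_norm_mul_tip_pow (homCarrier φ)).1 (homCarrier_data φ).2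
    let t : P ⟶ M := homMk (C0.toIsotropic P.carrier) htiso rfl
    let l : M ⟶ Q := homMk (C0.liftIsotropify (homCarrier φ) hQ) hliso (homCarrier_data φ).1
    have hfac : t ≫ l = φ := hom_ext (by
      rw [homCarrier_comp, homCarrier_homMk, homCarrier_homMk]
      exact C0.toIsotropic_comp_liftIsotropify _ hQ)
    rcases hirr t l hfac with hl | ht
    · haveI : IsIso (homCarrier l) := (isIso_iff_isIso_carrier l).1 hl
      exact C0.not_isIso_of_complex_real (homCarrier l) hP hQ inferInstance
    · haveI : IsIso (homCarrier t) := (isIso_iff_isIso_carrier t).1 ht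
      exact C0.not_isIso_toIsotropic P.carrier hPi (by
        change IsIso (homCarrier t); infer_instance)

/-- **"every FSMI-morphism of `F₀` has complex domain and codomain"** (p. 32 ll. 13–14), `F₀ = N₀`.
[cite: MochizukiFrdII2008, Prop 3.4 (viii) p.32] -/
theorem isComplexObj_of_isFSMI (φ : P ⟶ Q) (hφ : IsFSMI φ) :
    P.carrier.IsComplexObj ∧ Q.carrier.IsComplexObj := by
  rcases D0.isReal_or_isComplex P.carrier.base with hP | hP
  · exact absurd (isIso_of_isRealObj φ hP (isRealObj_of_hom φ hP)) hφ.2.1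
  rcases D0.isReal_or_isComplex Q.carrier.base with hQ | hQ
  · exact absurd hφ (not_isFSMI_of_isComplex_of_isReal φ hP hQ)
  exact ⟨hP, hQ⟩

/-! ### FSMI-morphisms between complex objects: non-isotropic source, isotropic target -/

/-- **An FSMI-morphism of `N₀` has non-isotropic domain and isotropic codomain** ("either an
isomorphism or a slit morphism", p. 32 ll. 15–18; Lemma 3.2 (ix) via the test sub-objects of `C₀`).
[cite: MochizukiFrdII2008, Prop 3.4 (viii) p.32] -/
theorem isIsotropic_of_isFSMI (φ : P ⟶ Q) (hφ : IsFSMI φ) :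
    ¬ P.carrier.region.IsIsotropic ∧ Q.carrier.region.IsIsotropic := by
  obtain ⟨hP, hQ⟩ := isComplexObj_of_isFSMI φ hφ
  obtain ⟨⟨hfs, -⟩, hnot, -⟩ := hφ
  have hnotc : ¬ IsIso (homCarrier φ) := fun h => hnot (isIso_of_isIso_carrier φ)
  haveI : IsIso (C0.Base (homCarrier φ)) := D0.isIso_of_isComplex _ hP hQ
  constructor
  · intro hPi
    exact hnotc (C0.isIso_of_isIsotropic (homCarrier φ) hPi (homCarrier_data φ).1
      ((A0.isIsometry_iff_norm_mul_tip_pow _).1 (homCarrier_data φ).2))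
  · refine C0.isIsotropic_of_linear_lifts (homCarrier φ) hP hQ (homCarrier_data φ).1
      (homCarrier_data φ).2 hnotc ?_
    intro D hD hDo hDQ
    let Z : N0 := ⟨⟨C0.subObj Q.carrier hQ D hD hDo⟩⟩
    obtain ⟨-, hl, -, hi⟩ := C0.subHom_data Q.carrier hQ hD hDo hDQ
    let γ : Z ⟶ Q := homMk (C0.subHom Q.carrier hQ hD hDo hDQ) hi hl
    obtain ⟨W, δP, δZ, hsq⟩ := hfs γ
    refine ⟨W.carrier, homCarrier δP, homCarrier δZ, ?_⟩
    have := congrArg homCarrier hsq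
    rwa [homCarrier_comp, homCarrier_comp, homCarrier_homMk] at this

/-- **The FSMI-potential drops along every FSMI-morphism of `N₀`.** [cite: MochizukiFrdII2008, Prop 3.4 (viii) p.32] -/
theorem fsmiRank_lt_of_isFSMI (φ : P ⟶ Q) (hφ : IsFSMI φ) :
    Q.carrier.fsmiRank < P.carrier.fsmiRank := by
  obtain ⟨hP, -⟩ := isComplexObj_of_isFSMI φ hφ
  obtain ⟨hPi, hQi⟩ := isIsotropic_of_isFSMI φ hφ
  exact C0.fsmiRank_lt_of_isIsotropic hP hPi (Or.inr hQi)

/-- The potential never increases along an arrow of `N₀`. [cite: MochizukiFrdII2008, Prop 3.4 (viii) p.32] -/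
theorem fsmiRank_le_of_hom (φ : P ⟶ Q) : Q.carrier.fsmiRank ≤ P.carrier.fsmiRank :=
  C0.fsmiRank_le_of_hom (homCarrier φ)

/-! ### Condition (b) of "FSMFF-type" for `N₀` -/

/-- A chain of `n` FSMI-morphisms out of `A` has `n ≤ C0.fsmiRank A`. [cite: MochizukiFrdII2008, Prop 3.4 (viii) p.32] -/
theorem isFSMIChain_le {A B : N0} {φ : A ⟶ B} {n : ℕ} (h : IsFSMIChain φ n) :
    n ≤ A.carrier.fsmiRank := by
  induction h with
  | single φ hφ => exact Nat.one_le_of_lt (fsmiRank_lt_of_isFSMI φ hφ)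
  | cons ψ χ n hψ _ ih => exact Nat.succ_le_of_lt (lt_of_le_of_lt ih (fsmiRank_lt_of_isFSMI ψ hψ))

/-- **Condition (b) of "FSMFF-type" (printed 2008 form) for `N₀`**: the lengths of chains of
FSMI-morphisms out of `A` are bounded (by `C0.fsmiRank A`). [cite: MochizukiFrdII2008, Prop 3.4 (viii) p.32] -/
theorem bounded_isFSMIChain (A : N0) :
    ∃ N : ℕ, ∀ {B : N0} (φ : A ⟶ B) (n : ℕ), IsFSMIChain φ n → n ≤ N :=
  ⟨A.carrier.fsmiRank, fun _ _ h => isFSMIChain_le h⟩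

/-- **Condition (b) of "FSMFF-type" (author's 2024 form: arbitrary head, FSMI tail) for `N₀`**: every
composite `φₙ ∘ ⋯ ∘ φ₂ ∘ φ₁` out of `A` with `φ₂, …, φₙ` FSMI has `n ≤ C0.fsmiRank A + 1` — the
integer "`N + 1`" of the proof of Prop. 3.4 (viii), p. 32 l. 30. [cite: MochizukiFrdII2008, Prop 3.4 (viii) p.32] -/
theorem bounded_headedFSMIChain (A : N0) :
    ∃ N : ℕ, ∀ {B : N0} (φ : A ⟶ B) (n : ℕ), IsHeadedFSMIChain ⊤ φ n → n ≤ N := by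
  refine ⟨A.carrier.fsmiRank + 1, fun φ n h => ?_⟩
  cases h with
  | single φ _ => exact Nat.succ_le_succ (Nat.zero_le _)
  | comp φ₁ χ m _ hχ =>
    exact Nat.succ_le_succ ((isFSMIChain_le hχ).trans (fsmiRank_le_of_hom φ₁))

end N0

end ArchFrd

end

end Literature.AlgebraicGeometry.Frobenioids
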